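import Summits.Ventures.Crystal3D.Theorems.StickyWulffConstantGenericWallFloorNonChainCriterion
import HarnessLib

/-!
# The sharper non-chain criterion: triadic rationals, covering all CSL pairs `Σ ≠ 3ⁿ`

HONEST FRAMING. Venture `Summits/Ventures/Crystal3D` (cell `crystal3d-full`), helper for the crux
`GenericWallFloor` (stmt-Ventures-19480) of `route-Ventures-StickyWulffConstant`, REGISTERED line `WallLedgerG`,
open stub `stub_twoSlabAdhesion` (general fillings; ARCH v4).  Rung credit only; F-C1 not moved.

`general_twoSlabAdhesion_irrational` misses the rational pairs — in particular every CSL pair (`Σ5, Σ7, …`), whose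
rotation matrices are rational.  The twin chain only ever introduces the denominator `3` (a `{111}` mirror is
`x ↦ x − (2/3)(x·k)k'` in frame coordinates with `k ∈ ℤ³`), so the frames `G` with TRIADIC-RATIONAL cubic inner
products `⟪A₁ cᵢ, G cⱼ⟫ ∈ ℤ[1/3]` form a mirror-closed set containing `A₁` (`triadicFrame_self`,
`triadicFrame_mirror`, `triadicFrame_slot`).  Hence **`general_twoSlabAdhesion_nonTriadic`**: the general-filling
two-slab inequality (constant `2/2809`, clean slivers, `KissingGap δ`/`KissingClassification δ` by name) holds for
every pair with ONE number `√2 ⟪A₁ cᵢ, A₂ w⟫ ∉ ℤ[1/3]` — this includes all irrational pairs AND all coincidence-site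
lattice pairs `Σ` with `3 ∤ Σ`… more precisely every pair whose rotation has a matrix entry with a denominator not a
power of `3` (e.g. `Σ5`: entries `3/5, 4/5`).
WHAT THIS IS NOT: not the stub; the `Σ3ⁿ` chain pairs remain excluded (there the `h`-term is needed); F-C1 not moved.
-/

noncomputable section

namespace Summit.Ventures.Crystal3D.Theorems

open Summit.Ventures.Crystal3D Finset
open Literature.MathematicalPhysics.StatisticalMechanics (fccStacking contactDeficiency)
open NearIdentity
open scoped InnerProductSpace

/-! ### Triadic rationals `a / 3ⁿ` (as a predicate on `ℝ`, closure under ring operations) -/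

/-- Sum of triadic rationals. -/
theorem triadic_add {x y : ℝ} (hx : ∃ (a : ℤ) (n : ℕ), x = a / 3 ^ n) (hy : ∃ (a : ℤ) (n : ℕ), y = a / 3 ^ n) :
    ∃ (a : ℤ) (n : ℕ), x + y = a / 3 ^ n := by
  obtain ⟨a, n, rfl⟩ := hx
  obtain ⟨b, m, rfl⟩ := hy
  refine ⟨a * 3 ^ m + b * 3 ^ n, n + m, ?_⟩
  push_cast
  rw [pow_add]
  field_simp

/-- Product of triadic rationals. -/
theorem triadic_mul {x y : ℝ} (hx : ∃ (a : ℤ) (n : ℕ), x = a / 3 ^ n) (hy : ∃ (a : ℤ) (n : ℕ), y = a / 3 ^ n) :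
    ∃ (a : ℤ) (n : ℕ), x * y = a / 3 ^ n := by
  obtain ⟨a, n, rfl⟩ := hx
  obtain ⟨b, m, rfl⟩ := hy
  refine ⟨a * b, n + m, ?_⟩
  push_cast
  rw [pow_add]
  field_simp

/-- Integers are triadic rationals. -/
theorem triadic_int (k : ℤ) : ∃ (a : ℤ) (n : ℕ), (k : ℝ) = a / 3 ^ n := ⟨k, 0, by simp⟩

/-- `2/3` is a triadic rational. -/
theorem triadic_twoThirds : ∃ (a : ℤ) (n : ℕ), (2 / 3 : ℝ) = a / 3 ^ n := ⟨2, 1, by norm_num⟩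

/-- Negation. -/
theorem triadic_neg {x : ℝ} (hx : ∃ (a : ℤ) (n : ℕ), x = a / 3 ^ n) : ∃ (a : ℤ) (n : ℕ), -x = a / 3 ^ n := by
  obtain ⟨a, n, rfl⟩ := hx
  exact ⟨-a, n, by push_cast; ring⟩

/-- Difference. -/
theorem triadic_sub {x y : ℝ} (hx : ∃ (a : ℤ) (n : ℕ), x = a / 3 ^ n) (hy : ∃ (a : ℤ) (n : ℕ), y = a / 3 ^ n) :
    ∃ (a : ℤ) (n : ℕ), x - y = a / 3 ^ n := by
  rw [sub_eq_add_neg]; exact triadic_add hx (triadic_neg hy)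

/-! ### The triadic frame set -/

/-- `A₁` is triadic relative to itself. -/
theorem triadicFrame_self (A₁ : EuclideanSpace ℝ (Fin 3) ≃ₗᵢ[ℝ] EuclideanSpace ℝ (Fin 3)) :
    ∀ i j : Fin 3, ∃ (a : ℤ) (n : ℕ), ⟪A₁ (cubicFrame i), A₁ (cubicFrame j)⟫_ℝ = a / 3 ^ n := by
  intro i j
  obtain ⟨q, hq⟩ := rationalFrame_self A₁ i j
  refine ⟨if j = i then 1 else 0, 0, ?_⟩
  rw [LinearIsometryEquiv.inner_map_map, inner_cubicFrame, cubicCoords_cubicFrame, Pi.single_apply]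
  split_ifs <;> simp

/-- Triadic rationality is preserved by `{111}` mirrors. -/
theorem triadicFrame_mirror (A₁ G G' : EuclideanSpace ℝ (Fin 3) ≃ₗᵢ[ℝ] EuclideanSpace ℝ (Fin 3))
    {m : EuclideanSpace ℝ (Fin 3)}
    (hG : ∀ i j : Fin 3, ∃ (a : ℤ) (n : ℕ), ⟪A₁ (cubicFrame i), G (cubicFrame j)⟫_ℝ = a / 3 ^ n)
    (hmenu : ∀ w ∈ fccSlots, ⟪G w, m⟫_ℝ = 0 ∨ ⟪G w, m⟫_ℝ = Real.sqrt (2 / 3) ∨ ⟪G w, m⟫_ℝ = -Real.sqrt (2 / 3))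
    (hG' : ∀ x, G' x = G x - (2 * ⟪G x, m⟫_ℝ) • m) :
    ∀ i j : Fin 3, ∃ (a : ℤ) (n : ℕ), ⟪A₁ (cubicFrame i), G' (cubicFrame j)⟫_ℝ = a / 3 ^ n := by
  intro i j
  have hs2 : Real.sqrt 2 * Real.sqrt 2 = 2 := Real.mul_self_sqrt (by norm_num)
  have hr2 : Real.sqrt (2 / 3) * Real.sqrt (2 / 3) = 2 / 3 := Real.mul_self_sqrt (by norm_num)
  choose k hk using frame_inner_menu G hmenu
  set Q : Fin 3 → Fin 3 → ℝ := fun i j => ⟪A₁ (cubicFrame i), G (cubicFrame j)⟫_ℝ with hQ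
  have hYY : ∀ l, 2 * ⟪G (cubicFrame j), m⟫_ℝ * ⟪G (cubicFrame l), m⟫_ℝ = 2 / 3 * (k j) * (k l) := by
    intro l
    linear_combination (⟪G (cubicFrame l), m⟫_ℝ * Real.sqrt 2) * hk j + (Real.sqrt (2 / 3) * k j) * hk l +
      (-(⟪G (cubicFrame j), m⟫_ℝ * ⟪G (cubicFrame l), m⟫_ℝ)) * hs2 + ((k j : ℝ) * k l) * hr2
  have hfm : ⟪A₁ (cubicFrame i), m⟫_ℝ = Q i 0 * ⟪G (cubicFrame 0), m⟫_ℝ +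
      Q i 1 * ⟪G (cubicFrame 1), m⟫_ℝ + Q i 2 * ⟪G (cubicFrame 2), m⟫_ℝ := by
    rw [inner_eq_sum_frame G]
    simp only [Fin.sum_univ_three, hQ]
    rw [real_inner_comm (G (cubicFrame 0)) m, real_inner_comm (G (cubicFrame 1)) m,
      real_inner_comm (G (cubicFrame 2)) m]
  have hval : ⟪A₁ (cubicFrame i), G' (cubicFrame j)⟫_ℝ =
      Q i j - 2 / 3 * (k j) * (Q i 0 * k 0 + Q i 1 * k 1 + Q i 2 * k 2) := by
    rw [hG', inner_sub_right, inner_smul_right, hfm]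
    have h0 := hYY 0
    have h1 := hYY 1
    have h2 := hYY 2
    simp only [hQ]
    linear_combination (-Q i 0) * h0 + (-Q i 1) * h1 + (-Q i 2) * h2
  rw [hval]
  have hQt : ∀ l, ∃ (a : ℤ) (n : ℕ), Q i l = a / 3 ^ n := fun l => hG i l
  exact triadic_sub (hQt j) (triadic_mul (triadic_mul triadic_twoThirds (triadic_int _))
    (triadic_add (triadic_add (triadic_mul (hQt 0) (triadic_int _)) (triadic_mul (hQt 1) (triadic_int _)))
      (triadic_mul (hQt 2) (triadic_int _))))

/-- Slots of a triadic lattice have triadic `√2·⟪A₁ cᵢ, ·⟫`. -/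
theorem triadicFrame_slot (A₁ G : EuclideanSpace ℝ (Fin 3) ≃ₗᵢ[ℝ] EuclideanSpace ℝ (Fin 3))
    (hG : ∀ i j : Fin 3, ∃ (a : ℤ) (n : ℕ), ⟪A₁ (cubicFrame i), G (cubicFrame j)⟫_ℝ = a / 3 ^ n) (i : Fin 3)
    {w : EuclideanSpace ℝ (Fin 3)} (hw : w ∈ fccSlots) :
    ∃ (a : ℤ) (n : ℕ), Real.sqrt 2 * ⟪A₁ (cubicFrame i), G w⟫_ℝ = a / 3 ^ n := by
  obtain ⟨κ, rfl⟩ := exists_slotSite_eq hw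
  have hc : ∀ l, ⟪G (slotSite κ), G (cubicFrame l)⟫_ℝ = (slotInt κ l : ℝ) / Real.sqrt 2 := by
    intro l
    rw [LinearIsometryEquiv.inner_map_map, inner_cubicFrame, cubicCoords_slotSite]; rfl
  have hs0 : Real.sqrt 2 ≠ 0 := by positivity
  have hval : Real.sqrt 2 * ⟪A₁ (cubicFrame i), G (slotSite κ)⟫_ℝ =
      ⟪A₁ (cubicFrame i), G (cubicFrame 0)⟫_ℝ * (slotInt κ 0 : ℝ) +
        ⟪A₁ (cubicFrame i), G (cubicFrame 1)⟫_ℝ * (slotInt κ 1 : ℝ) +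
        ⟪A₁ (cubicFrame i), G (cubicFrame 2)⟫_ℝ * (slotInt κ 2 : ℝ) := by
    rw [inner_eq_sum_frame G (A₁ (cubicFrame i))]
    simp only [Fin.sum_univ_three, hc]
    field_simp
  rw [hval]
  exact triadic_add (triadic_add (triadic_mul (hG i 0) (triadic_int _)) (triadic_mul (hG i 1) (triadic_int _)))
    (triadic_mul (hG i 2) (triadic_int _))

open scoped Classical in
/-- **The general-filling rung for non-triadic pairs** (all irrational pairs and all CSL pairs `Σ` with an
entry denominator not a power of `3`).  See the module docstring. -/
theorem general_twoSlabAdhesion_nonTriadic {δ : ℝ} (hg : KissingGap δ) (hc : KissingClassification δ)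
    (A₁ : EuclideanSpace ℝ (Fin 3) ≃ₗᵢ[ℝ] EuclideanSpace ℝ (Fin 3)) (t₁ : EuclideanSpace ℝ (Fin 3))
    (A₂ : EuclideanSpace ℝ (Fin 3) ≃ₗᵢ[ℝ] EuclideanSpace ℝ (Fin 3)) (t₂ : EuclideanSpace ℝ (Fin 3))
    (hnt : ∃ i : Fin 3, ∃ w ∈ fccSlots, ∀ (a : ℤ) (n : ℕ),
      Real.sqrt 2 * ⟪A₁ (cubicFrame i), A₂ w⟫_ℝ ≠ a / 3 ^ n) :
    ∃ C R₀ : ℝ, 1 ≤ R₀ ∧ ∀ h : ℝ, 0 ≤ h → ∀ ρ : ℝ, R₀ ≤ ρ →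
      ∀ X P₁ P₂ : Finset (EuclideanSpace ℝ (Fin 3)),
      (∀ p ∈ X, ∀ q ∈ X, p ≠ q → 1 ≤ dist p q) → P₁ ⊆ X → P₂ ⊆ X \ P₁ →
      (∀ p ∈ X, -(2 * R₀) ≤ p 2 ∧ p 2 ≤ h + 2 * R₀ ∧ p 0 ^ 2 + p 1 ^ 2 ≤ ρ ^ 2) →
      (∀ p, p ∈ P₁ ↔ (p ∈ (fun q => A₁ q + t₁) '' fccStacking 1 (Real.sqrt (2 / 3)) ∧
        -(2 * R₀) ≤ p 2 ∧ p 2 ≤ -R₀ ∧ p 0 ^ 2 + p 1 ^ 2 ≤ ρ ^ 2)) →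
      (∀ p, p ∈ P₂ ↔ (p ∈ (fun q => A₂ q + t₂) '' fccStacking 1 (Real.sqrt (2 / 3)) ∧
        h + R₀ ≤ p 2 ∧ p 2 ≤ h + 2 * R₀ ∧ p 0 ^ 2 + p 1 ^ 2 ≤ ρ ^ 2)) →
      (∀ p ∈ X, p 2 < -(2 * R₀) + 1 → p ∈ (fun q => A₁ q + t₁) '' fccStacking 1 (Real.sqrt (2 / 3))) →
      (∀ p ∈ X, h + 2 * R₀ - 1 < p 2 → p ∈ (fun q => A₂ q + t₂) '' fccStacking 1 (Real.sqrt (2 / 3))) →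
      ((((P₁ ×ˢ (X \ P₁)).filter fun pq => dist pq.1 pq.2 = 1).card : ℕ) : ℝ) +
        ((((P₂ ×ˢ ((X \ P₁) \ P₂)).filter fun pq => dist pq.1 pq.2 = 1).card : ℕ) : ℝ) ≤
        contactDeficiency ((X \ P₁) \ P₂) +
          (Real.sqrt 2 / 4 * ∑ᶠ w ∈ {w ∈ fccStacking 1 (Real.sqrt (2 / 3)) | ‖w‖ = 1},
              |⟪w, A₁.symm (EuclideanSpace.single (2 : Fin 3) (1 : ℝ))⟫_ℝ| +
            Real.sqrt 2 / 4 * ∑ᶠ w ∈ {w ∈ fccStacking 1 (Real.sqrt (2 / 3)) | ‖w‖ = 1},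
              |⟪w, A₂.symm (EuclideanSpace.single (2 : Fin 3) (1 : ℝ))⟫_ℝ|) * Real.pi * ρ ^ 2 -
          2 / 2809 * ρ ^ 2 + C * (1 + h) * ρ := by
  set 𝓕 : Set (EuclideanSpace ℝ (Fin 3) ≃ₗᵢ[ℝ] EuclideanSpace ℝ (Fin 3)) :=
    {G | ∀ i j : Fin 3, ∃ (a : ℤ) (n : ℕ), ⟪A₁ (cubicFrame i), G (cubicFrame j)⟫_ℝ = a / 3 ^ n} with h𝓕
  refine general_twoSlabAdhesion_nonChain hg hc A₁ t₁ A₂ t₂ 𝓕 (triadicFrame_self A₁) ?_ ?_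
  · intro G hG heq
    obtain ⟨i, w, hw, hnt⟩ := hnt
    have hA₂w : A₂ w ∈ G '' fccStacking 1 (Real.sqrt (2 / 3)) := by
      rw [heq]; exact ⟨w, mem_fcc_of_mem_fccSlots hw, rfl⟩
    obtain ⟨y, hy, hyw⟩ := hA₂w
    have hy1 : ‖y‖ = 1 := by
      have := congrArg norm hyw
      rw [LinearIsometryEquiv.norm_map, LinearIsometryEquiv.norm_map, norm_eq_one_of_mem_fccSlots hw] at this
      exact this
    have hys : y ∈ fccSlots := mem_fccSlots_of_unit hy hy1
    obtain ⟨a, n, han⟩ := triadicFrame_slot A₁ G hG i hys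
    rw [hyw] at han
    exact hnt a n han
  · intro G hG m _ hmenu G' hG'
    exact triadicFrame_mirror A₁ G G' hG hmenu hG'

end Summit.Ventures.Crystal3D.Theorems

end
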